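import Literature.NumberTheory.LFunctions.DedekindZetaProofs
import Literature.NumberTheory.Sieve.HeathBrownCubicFLProducts
import Literature.NumberTheory.Sieve.HeathBrownCubicFLRemaindersA
import HarnessLib

/-!
# Mertens' theorem for the prime ideals of `ℚ(∛2)` with the residue constant (Heath-Brown (6.9))

Seventh file of the proof of the named fact `HeathBrown2001_lemma_3_5` (`HeathBrownCubicSieveDecomposition`;
D. R. Heath-Brown, *Primes represented by `x³ + 2y³`*, Acta Math. 186 (2001), §6). It PROVES the
Mertens theorem for `K = ℚ(∛2)` that the assembly `HeathBrownCubicFLAssembly.HeathBrown2001_lemma_3_5_of`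
takes as the hypothesis `hmer` (Heath-Brown's (6.9); M. Rosen, *A generalization of Mertens' theorem*,
J. Ramanujan Math. Soc. 14 (1999), Thm 2):

`mertensK_grouped : ∃ C z₀, ∀ z ≥ z₀, |∏_{p<z}∏_{P∣p}(1 − N(P)^{-1}) · e^γ γ₀ log z − 1| ≤ C/log z`,

`γ₀ = ρ_K` the residue of `ζ_K` at `s = 1`. No named fact is introduced.

## The proof (Hardy–Wright §22.8 transposed to `K`, grouped by rational primes)

* (M1) For real `s > 1` the Euler product `ζ_K(s) = ∏_v (1 − N(v)^{-s})^{-1}` holds in `ℝ` (from the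
  tree's complex `hasProd_dedekindEulerFactor_holds`), hence `log ζ_K(s) = ∑_v −log(1 − N(v)^{-s})`.
* (M2) Grouping the nonzero primes `v` by the rational prime below (`primesEquivSigma`, fibres
  `primesAbove p` of `HeathBrownCubicNormWindowSieve`): `log ζ_K(s) = ∑_p b_p(s)`,
  `b_p(s) = ∑_{P∣p} −log(1 − N(P)^{-s})`.
* (M3) `b_p(s) = c_K(p)p^{-s} + r_p(s)` with `0 ≤ r_p(s) ≤ 6/p²` for `s ≥ 1` (degree-one primes give
  `c_K(p) = ν_p` terms `p^{-s}`; everything else is `O(p^{-2})`; at most `3` primes above `p`).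
* (M4) `D(σ) = ∑_p c_K(p)p^{-1-σ} = σ∫_1^∞ M'(x)x^{-σ-1}dx`, `M'(x) = ∑_{p≤x} c_K(p)/p` (Mathlib's
  `LSeries_eq_mul_integral'`, made real).
* (M5) As `σ → 0⁺`: `D(σ) + log σ → c − γ` (the degree-one Mertens theorem with rate
  `M'(x) = log log x + c + O(1/log x)`, tree `sum_primesLE_idealNormCount_div_eq`, the Abelian lemma
  `Mertens.tendsto_mul_integral_rpow_of_tendsto` and `σ∫ log log x·x^{-σ-1} = −γ − log σ`,
  `Nicolas.integral_loglog_rpow`); `∑_p r_p(1+σ) → R = ∑_p r_p(1)` (dominated convergence);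
  `log ζ_K(1+σ) + log σ → log ρ_K` (Mathlib's class number formula
  `NumberField.tendsto_sub_one_mul_dedekindZeta_nhdsGT`). Hence **`c − γ + R = log γ₀`** (`mertensK_constant`).
* (M6) `∑_{p<z} b_p(1) = M'(⌈z⌉−1) + R − (tail) = log log z + γ + log γ₀ + O(1/log z)`
  (`exists_abs_sum_bTerm_sub_le`), and `∏_{p<z}(1 − normDensityAt p) = exp(−∑_{p<z} b_p(1))`.

## Content (namespace `Literature.NumberTheory.Sieve.CubicSieve`), all proved

`two_le_absNorm_asIdeal`, `realEulerFactor`, `realEulerFactor_bounds`, `dedekindEulerFactor_ofReal`,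
**`hasProd_realEulerFactor`**, **`hasSum_neg_log_one_sub_absNorm_rpow`** (any number field); `belowPrime`,
`belowPrime_spec`, `primesEquivSigma`, `bTerm`, **`hasSum_bTerm`**; `neg_log_one_sub_bounds`, `rTerm`,
`card_primesAbove_filter_absNorm_eq`, **`rTerm_bounds`**, `abs_rTerm_le`, `continuousOn_rTerm`; `cWeight`,
`cSum`, `sum_Icc_cWeight`, `cSum_bounds`, `measurable_cSum`, `integrableOn_cSum_rpow`,
**`hasSum_cWeight_rpow`**; `tendsto_cSum_sub_loglog`, **`tendsto_D_add_log`**, `tendsto_tsum_rTerm`,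
`summable_rTerm`, **`tendsto_log_zeta_add_log`**, `bTerm_eq_add`, `log_zeta_eq`, **`mertensK_constant`**;
`sum_primesBelow_cWeight`, `abs_tsum_rTerm_tail_le`, **`exists_abs_sum_bTerm_sub_le`**,
`one_sub_normDensityAt_eq_exp`, **`mertensK_grouped`**.

## References

* M. Rosen, *A generalization of Mertens' theorem*, J. Ramanujan Math. Soc. 14 (1999), 1–19, Thm 2.
  [cite: Rosen1999Mertens, Thm 2]
* D. R. Heath-Brown, *Primes represented by `x³ + 2y³`*, Acta Math. 186 (2001), §6 (6.9).
  [cite: HeathBrownActa2001, §6 (6.9)]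
* G. H. Hardy, E. M. Wright, *An Introduction to the Theory of Numbers*, §22.8, proof of Thm 428 (the
  method). [cite: HardyWright2008, §22.8]

## Mathlib / tree search

Mathlib: `NumberField.tendsto_sub_one_mul_dedekindZeta_nhdsGT`, `NumberField.dedekindZeta_residue_pos`,
`LSeries_eq_mul_integral'`, `LSeriesSummable_of_sum_norm_bigO`, `tendsto_tsum_of_dominated_convergence`,
`HasSum.sigma`, `Equiv.hasSum_iff`, `hasSum_subtype_iff_indicator`, `Real.abs_log_sub_add_sum_range_le`,
`Real.log_le_rpow_div`, `harmonic_le_one_add_log`, `integral_complex_ofReal`, `Complex.ofReal_cpow`. Tree: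
`LFunctions.DedekindZetaProofs` (`hasProd_dedekindEulerFactor_holds`), `LFunctions.DegreeOnePrimesPNT`
(`sum_primesLE_idealNormCount_div_eq`), `LFunctions.MertensConstant` (`Mertens.tendsto_mul_integral_rpow_of_tendsto`),
`LFunctions.NicolasMellin` (`integral_loglog_rpow`, `integrableOn_loglog_rpow`, `integrableOn_rpow_of_le_log`,
`integrableOn_sub_rpow`), `HeathBrownCubicNormWindowSieve` (`primesAbove`, `mem_primesAbove_iff`,
`card_primesAbove_le`, `isPrime_of_mem_primesAbove`, `normDensityAt`), `HeathBrownCubicFLProducts`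
(`singularFactor_bounds`, `primesBelow_eq_primesLE`), `HeathBrownCubicFLRemaindersA` (`tsum_inv_sq_tail_le`),
`HeathBrownCubicFLSequencesA` (`exists_absNorm_eq_prime_pow'`, `normEq`, `card_normEq`),
`HeathBrownCubicSieveSetup` (`gamma₀ := dedekindZeta_residue K`, `gamma₀_pos`).
-/

noncomputable section

open Polynomial NumberField Finset Filter Topology IsDedekindDomain

namespace Literature.NumberTheory.Sieve.CubicSieve

open LFunctions.CubeRootTwoField CubicPrimes
open Literature.NumberTheory.LFunctions (idealNormCount)

/-! ### (M1) The Euler product of `ζ_L` at real `s > 1`, with logarithms (any number field `L`) -/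

section general

variable {L : Type*} [Field L] [NumberField L]

/-- Norms of nonzero primes are `≥ 2`. [folklore] -/
theorem two_le_absNorm_asIdeal (v : HeightOneSpectrum (𝓞 L)) : (2 : ℝ) ≤ Ideal.absNorm v.asIdeal := by
  have h0 : Ideal.absNorm v.asIdeal ≠ 0 := fun h => v.ne_bot (Ideal.absNorm_eq_zero_iff.mp h)
  have h1 : Ideal.absNorm v.asIdeal ≠ 1 := fun h => v.isPrime.ne_top (Ideal.absNorm_eq_one_iff.mp h)
  have : 2 ≤ Ideal.absNorm v.asIdeal := by omega
  exact_mod_cast this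

/-- The real Euler factor `(1 − N(v)^{-s})^{-1}` at a nonzero prime `v` and real `s`. [folklore] -/
def realEulerFactor (v : HeightOneSpectrum (𝓞 L)) (s : ℝ) : ℝ :=
  (1 - (Ideal.absNorm v.asIdeal : ℝ) ^ (-s))⁻¹

/-- For real `s > 0`: `0 ≤ N(v)^{-s} ≤ 2^{-s} < 1`, so the real Euler factor is `≥ 1`. [folklore] -/
theorem realEulerFactor_bounds (v : HeightOneSpectrum (𝓞 L)) {s : ℝ} (hs : 0 < s) :
    0 < (Ideal.absNorm v.asIdeal : ℝ) ^ (-s) ∧ (Ideal.absNorm v.asIdeal : ℝ) ^ (-s) ≤ (2 : ℝ) ^ (-s) ∧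
      (2 : ℝ) ^ (-s) < 1 ∧ 1 ≤ realEulerFactor v s := by
  have h2 := two_le_absNorm_asIdeal v
  have hN0 : (0 : ℝ) < Ideal.absNorm v.asIdeal := by linarith
  have ha : 0 < (Ideal.absNorm v.asIdeal : ℝ) ^ (-s) := Real.rpow_pos_of_pos hN0 _
  have hb : (Ideal.absNorm v.asIdeal : ℝ) ^ (-s) ≤ (2 : ℝ) ^ (-s) :=
    Real.rpow_le_rpow_of_nonpos (by norm_num) h2 (by linarith)
  have hc : (2 : ℝ) ^ (-s) < 1 := Real.rpow_lt_one_of_one_lt_of_neg (by norm_num) (by linarith)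
  refine ⟨ha, hb, hc, ?_⟩
  rw [realEulerFactor]
  exact one_le_inv_iff₀.mpr ⟨by linarith, by linarith⟩

/-- The complex Euler factor at a real `s` is the real one. [folklore] -/
theorem dedekindEulerFactor_ofReal (v : HeightOneSpectrum (𝓞 L)) (s : ℝ) :
    Literature.NumberTheory.LFunctions.dedekindEulerFactor L v (s : ℂ) = (realEulerFactor v s : ℂ) := by
  rw [Literature.NumberTheory.LFunctions.dedekindEulerFactor, realEulerFactor]
  have hN0 : (0 : ℝ) ≤ Ideal.absNorm v.asIdeal := Nat.cast_nonneg _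
  rw [show ((Ideal.absNorm v.asIdeal : ℕ) : ℂ) = (((Ideal.absNorm v.asIdeal : ℕ) : ℝ) : ℂ) by norm_cast,
    show (-(s : ℂ)) = ((-s : ℝ) : ℂ) by push_cast; ring, ← Complex.ofReal_cpow hN0]
  push_cast
  rfl

/-- **The Euler product of `ζ_L` at real `s > 1`, in `ℝ`**: `∏_v (1 − N(v)^{-s})^{-1} = ζ_L(s)` (as a
`HasProd` of real numbers), `ζ_L(s)` is real and `≥ 1`. From the tree's complex Euler product
`hasProd_dedekindEulerFactor_holds`. [cite: NeukirchANT1999, Prop. VII.5.2] -/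
theorem hasProd_realEulerFactor {s : ℝ} (hs : 1 < s) :
    HasProd (fun v : HeightOneSpectrum (𝓞 L) => realEulerFactor v s) (NumberField.dedekindZeta L s).re ∧
      (NumberField.dedekindZeta L s : ℂ) = ((NumberField.dedekindZeta L s).re : ℂ) ∧
      1 ≤ (NumberField.dedekindZeta L s).re := by
  have hC := Literature.NumberTheory.LFunctions.hasProd_dedekindEulerFactor_holds (K := L) (s := (s : ℂ))
    (by simpa using hs)
  simp_rw [dedekindEulerFactor_ofReal] at hC
  -- partial products are real
  have hpart : ∀ S : Finset (HeightOneSpectrum (𝓞 L)),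
      ∏ v ∈ S, (realEulerFactor v s : ℂ) = ((∏ v ∈ S, realEulerFactor v s : ℝ) : ℂ) := fun S => by
    rw [Complex.ofReal_prod]
  have hC' : Tendsto (fun S : Finset (HeightOneSpectrum (𝓞 L)) => ((∏ v ∈ S, realEulerFactor v s : ℝ) : ℂ)) atTop
      (𝓝 (NumberField.dedekindZeta L s)) :=
    (hC).congr fun S => hpart S
  -- real part
  have hre : HasProd (fun v : HeightOneSpectrum (𝓞 L) => realEulerFactor v s) (NumberField.dedekindZeta L s).re := by
    have h := (Complex.continuous_re.tendsto _).comp hC'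
    simp only [Function.comp_def, Complex.ofReal_re] at h
    exact h
  -- imaginary part vanishes
  have him : (NumberField.dedekindZeta L s).im = 0 := by
    have h := (Complex.continuous_im.tendsto _).comp hC'
    simp only [Function.comp_def, Complex.ofReal_im] at h
    exact tendsto_nhds_unique h tendsto_const_nhds
  have hreal : (NumberField.dedekindZeta L s : ℂ) = ((NumberField.dedekindZeta L s).re : ℂ) :=
    Complex.ext (by simp) (by simp [him])
  -- `≥ 1`
  have hge : 1 ≤ (NumberField.dedekindZeta L s).re := by
    refine ge_of_tendsto hre (Filter.Eventually.of_forall fun S => ?_)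
    calc (1 : ℝ) = ∏ _v ∈ S, (1 : ℝ) := prod_const_one.symm
      _ ≤ ∏ v ∈ S, realEulerFactor v s :=
          prod_le_prod (fun _ _ => zero_le_one) fun v _ => (realEulerFactor_bounds v (by linarith)).2.2.2
  exact ⟨hre, hreal, hge⟩

/-- **Logarithmic form**: for real `s > 1`, `∑_v −log(1 − N(v)^{-s}) = log ζ_L(s)` (a `HasSum` of
nonnegative reals). [cite: NeukirchANT1999, Prop. VII.5.2] -/
theorem hasSum_neg_log_one_sub_absNorm_rpow {s : ℝ} (hs : 1 < s) :
    HasSum (fun v : HeightOneSpectrum (𝓞 L) => -Real.log (1 - (Ideal.absNorm v.asIdeal : ℝ) ^ (-s)))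
      (Real.log (NumberField.dedekindZeta L s).re) := by
  obtain ⟨hprod, -, hge⟩ := hasProd_realEulerFactor (L := L) hs
  have hpos : ∀ v : HeightOneSpectrum (𝓞 L), 0 < realEulerFactor v s := fun v =>
    lt_of_lt_of_le one_pos (realEulerFactor_bounds v (by linarith)).2.2.2
  -- logs of the partial products
  have hlog : Tendsto (fun S : Finset (HeightOneSpectrum (𝓞 L)) => Real.log (∏ v ∈ S, realEulerFactor v s)) atTop
      (𝓝 (Real.log (NumberField.dedekindZeta L s).re)) :=
    ((Real.continuousAt_log (by linarith)).tendsto).comp hprod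
  refine (hlog.congr fun S => ?_)
  rw [Real.log_prod fun v _ => (hpos v).ne']
  refine sum_congr rfl fun v _ => ?_
  rw [realEulerFactor, Real.log_inv]

end general


/-! ### (M2) Grouping the Euler product of `ζ_K`, `K = ℚ(∛2)`, by rational primes -/

/-- The rational prime under a nonzero prime `v` of `𝓞 K` (`N(v) = p^f`). [folklore] -/
def belowPrime (v : HeightOneSpectrum (𝓞 K)) : ℕ := (Ideal.absNorm v.asIdeal).minFac

/-- `belowPrime v` is the prime `p` with `N(v) = p^f`, and `v.asIdeal ∈ primesAbove p`. [folklore] -/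
theorem belowPrime_spec (v : HeightOneSpectrum (𝓞 K)) :
    (belowPrime v).Prime ∧ v.asIdeal ∈ primesAbove (belowPrime v) ∧
      ∀ p : ℕ, p.Prime → v.asIdeal ∈ primesAbove p → p = belowPrime v := by
  obtain ⟨q, f, hq, hf, hN⟩ := exists_absNorm_eq_prime_pow' v.isPrime v.ne_bot
  have hu : belowPrime v = q := by rw [belowPrime, hN, hq.pow_minFac hf.ne']
  rw [hu]
  refine ⟨hq, (mem_primesAbove_iff hq).mpr ⟨v.isPrime, v.ne_bot, hN ▸ dvd_pow_self q hf.ne'⟩, fun p hp hmem => ?_⟩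
  obtain ⟨-, -, hpN⟩ := (mem_primesAbove_iff hp).mp hmem
  rw [hN] at hpN
  exact (Nat.prime_dvd_prime_iff_eq hp hq).mp (hp.dvd_of_dvd_pow hpN)

/-- **The nonzero primes of `𝓞 K` ≃ pairs (rational prime `p`, prime of `primesAbove p`).** [folklore] -/
def primesEquivSigma : HeightOneSpectrum (𝓞 K) ≃ Σ p : Nat.Primes, (primesAbove (p : ℕ)) where
  toFun v := ⟨⟨belowPrime v, (belowPrime_spec v).1⟩, ⟨v.asIdeal, (belowPrime_spec v).2.1⟩⟩
  invFun x := ⟨x.2.1, (isPrime_of_mem_primesAbove x.2.2).1, (isPrime_of_mem_primesAbove x.2.2).2⟩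
  left_inv v := by ext1; rfl
  right_inv x := by
    obtain ⟨⟨p, hp⟩, ⟨P, hP⟩⟩ := x
    have hu : belowPrime ⟨P, (isPrime_of_mem_primesAbove hP).1, (isPrime_of_mem_primesAbove hP).2⟩ = p :=
      ((belowPrime_spec _).2.2 p hp hP).symm
    -- equality in the sigma type
    refine Sigma.ext (Subtype.ext hu) ?_
    exact (Subtype.heq_iff_coe_eq fun x => by dsimp only; rw [hu]).mpr rfl

/-- The grouped logarithmic Euler factor `b_p(s) = ∑_{P ∣ p} −log(1 − N(P)^{-s})` (zero at non-primes). [folklore] -/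
def bTerm (p : ℕ) (s : ℝ) : ℝ :=
  if p.Prime then ∑ P ∈ primesAbove p, -Real.log (1 - ((Ideal.absNorm P : ℕ) : ℝ) ^ (-s)) else 0

/-- **`log ζ_K(s) = ∑_p b_p(s)`** for real `s > 1` (the Euler product grouped by rational primes).
[cite: NeukirchANT1999, Prop. VII.5.2] -/
theorem hasSum_bTerm {s : ℝ} (hs : 1 < s) :
    HasSum (fun p : ℕ => bTerm p s) (Real.log (NumberField.dedekindZeta K s).re) := by
  have h := hasSum_neg_log_one_sub_absNorm_rpow (L := K) hs
  -- transport along the equivalence and sum the finite fibres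
  rw [← (primesEquivSigma.symm).hasSum_iff] at h
  set g : Ideal (𝓞 K) → ℝ := fun P => -Real.log (1 - ((Ideal.absNorm P : ℕ) : ℝ) ^ (-s)) with hg
  have hfib : ∀ p : Nat.Primes, HasSum (fun c : (primesAbove (p : ℕ)) =>
      ((fun v : HeightOneSpectrum (𝓞 K) => -Real.log (1 - (Ideal.absNorm v.asIdeal : ℝ) ^ (-s))) ∘ primesEquivSigma.symm) ⟨p, c⟩)
      (∑ P ∈ primesAbove (p : ℕ), g P) := by
    intro p
    have h1 := hasSum_fintype (fun c : (primesAbove (p : ℕ)) => g (c : Ideal (𝓞 K)))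
    rw [Finset.sum_coe_sort] at h1
    exact h1
  have hsig := h.sigma hfib
  -- from `Nat.Primes` to `ℕ` with the indicator
  rw [show (fun p : ℕ => bTerm p s) = Set.indicator {p : ℕ | p.Prime} (fun p => ∑ P ∈ primesAbove p, g P) by
    ext p; simp only [bTerm, hg, Set.indicator_apply, Set.mem_setOf_eq]]
  exact (hasSum_subtype_iff_indicator.mp hsig)


/-! ### (M3) `b_p(s) = c_K(p) p^{-s} + r_p(s)` with `0 ≤ r_p(s) ≤ 6/p²` for `s ≥ 1` -/

/-- Elementary: for `0 ≤ u ≤ 1/2`, `0 ≤ −log(1−u) − u ≤ 2u²` and `0 ≤ −log(1−u) ≤ 2u`. [folklore] -/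
theorem neg_log_one_sub_bounds {u : ℝ} (hu0 : 0 ≤ u) (hu : u ≤ 1 / 2) :
    0 ≤ -Real.log (1 - u) - u ∧ -Real.log (1 - u) - u ≤ 2 * u ^ 2 ∧ 0 ≤ -Real.log (1 - u) ∧ -Real.log (1 - u) ≤ 2 * u := by
  have h1u : 0 < 1 - u := by linarith
  have hA : Real.log (1 - u) ≤ -u := by linarith [Real.log_le_sub_one_of_pos h1u]
  have hB : 1 - (1 - u)⁻¹ ≤ Real.log (1 - u) := Real.one_sub_inv_le_log_of_pos h1u
  have hinv : (1 - u)⁻¹ ≤ 1 + 2 * u := by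
    rw [inv_le_iff_one_le_mul₀ h1u]; nlinarith
  have hT := Real.abs_log_sub_add_sum_range_le (show |u| < 1 by rw [abs_of_nonneg hu0]; linarith) 1
  simp only [sum_range_one, Nat.cast_zero, zero_add, pow_one, div_one] at hT
  rw [abs_of_nonneg hu0] at hT
  have hT' : |u + Real.log (1 - u)| ≤ 2 * u ^ 2 := by
    refine hT.trans ?_
    rw [show (1 : ℕ) + 1 = 2 from rfl, div_le_iff₀ (by linarith)]
    nlinarith [sq_nonneg u]
  have := (abs_le.mp hT').1
  refine ⟨by linarith, by linarith, by linarith, by linarith⟩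

/-- The error term `r_p(s) = b_p(s) − c_K(p)p^{-s}` (zero at non-primes). [folklore] -/
def rTerm (p : ℕ) (s : ℝ) : ℝ :=
  if p.Prime then bTerm p s - (cubeRootTwoCount p : ℝ) * (p : ℝ) ^ (-s) else 0

open scoped Classical in
/-- The first-degree members of `primesAbove p` are exactly the ideals of norm `p`, `c_K(p) = ν_p` of them.
[folklore] -/
theorem card_primesAbove_filter_absNorm_eq {p : ℕ} (hp : p.Prime) :
    (#((primesAbove p).filter (fun P => Ideal.absNorm P = p)) : ℝ) = cubeRootTwoCount p := by
  rw [← (singularFactor_bounds hp).2, ← card_normEq p]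
  congr 2
  ext P
  rw [mem_filter, mem_normEq, mem_primesAbove_iff hp]
  constructor
  · exact fun h => h.2
  · intro h
    have hP : P.IsPrime := Ideal.isPrime_of_irreducible_absNorm (h ▸ hp.prime.irreducible)
    have hP0 : P ≠ ⊥ := fun h0 => by rw [h0, Ideal.absNorm_bot] at h; exact hp.ne_zero h.symm
    exact ⟨⟨hP, hP0, h ▸ dvd_rfl⟩, h⟩

open scoped Classical in
/-- **`0 ≤ r_p(s) ≤ 6/p²` for `s ≥ 1`**: each `P ∣ p` of degree one contributes
`−log(1 − p^{-s}) − p^{-s} ∈ [0, 2p^{-2}]`, each `P` of degree `≥ 2` contributes `−log(1 − N(P)^{-s}) ∈ [0, 2p^{-2}]`,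
and there are at most `3` of them. [folklore] -/
theorem rTerm_bounds {p : ℕ} (hp : p.Prime) {s : ℝ} (hs : 1 ≤ s) : 0 ≤ rTerm p s ∧ rTerm p s ≤ 6 / (p : ℝ) ^ 2 := by
  have hp2 : (2 : ℝ) ≤ p := by exact_mod_cast hp.two_le
  have hp0 : (0 : ℝ) < p := by linarith
  -- per-`P` terms
  set T : Ideal (𝓞 K) → ℝ := fun P => -Real.log (1 - ((Ideal.absNorm P : ℕ) : ℝ) ^ (-s)) -
    (if Ideal.absNorm P = p then (p : ℝ) ^ (-s) else 0) with hT
  have hdecomp : rTerm p s = ∑ P ∈ primesAbove p, T P := by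
    rw [rTerm, if_pos hp, bTerm, if_pos hp, hT, sum_sub_distrib, ← card_primesAbove_filter_absNorm_eq hp]
    congr 1
    rw [sum_ite, sum_const_zero, add_zero, sum_const, nsmul_eq_mul]
  have hterm : ∀ P ∈ primesAbove p, 0 ≤ T P ∧ T P ≤ 2 / (p : ℝ) ^ 2 := by
    intro P hP
    obtain ⟨hPp, hP0, hpN⟩ := (mem_primesAbove_iff hp).mp hP
    obtain ⟨q, f, hq, hf, hN⟩ := exists_absNorm_eq_prime_pow' hPp hP0
    have hqp : q = p := ((Nat.prime_dvd_prime_iff_eq hp hq).mp (hp.dvd_of_dvd_pow (hN ▸ hpN))).symm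
    subst hqp
    have hps : (q : ℝ) ^ (-s) ≤ (q : ℝ)⁻¹ := by
      rw [← Real.rpow_neg_one]; exact Real.rpow_le_rpow_of_exponent_le (by linarith) (by linarith)
    have hpinv : (q : ℝ)⁻¹ ≤ 1 / 2 := by rw [inv_eq_one_div]; exact one_div_le_one_div_of_le two_pos hp2
    simp only [hT, hN]
    by_cases hf1 : f = 1
    · -- degree one
      subst hf1
      rw [pow_one, if_pos rfl]
      set u := (q : ℝ) ^ (-s) with hu
      have hu0 : 0 ≤ u := (Real.rpow_pos_of_pos hp0 _).le
      have hu2 : u ≤ 1 / 2 := hps.trans hpinv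
      obtain ⟨h1, h2, -, -⟩ := neg_log_one_sub_bounds hu0 hu2
      refine ⟨h1, h2.trans ?_⟩
      -- `2u² ≤ 2/p²` since `u ≤ 1/p`
      have : u ^ 2 ≤ ((q : ℝ)⁻¹) ^ 2 := pow_le_pow_left₀ hu0 hps 2
      rw [inv_pow] at this
      rw [div_eq_mul_inv]; linarith
    · -- degree ≥ 2
      have hf2 : 2 ≤ f := by omega
      have hne : q ^ f ≠ q := by
        intro h
        have : q ^ f = q ^ 1 := by rw [h, pow_one]
        exact hf1 (Nat.pow_right_injective hq.two_le this)
      rw [if_neg hne, sub_zero]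
      push_cast
      set u := ((q : ℝ) ^ f) ^ (-s) with hu
      have hqf0 : (0 : ℝ) < (q : ℝ) ^ f := by positivity
      have hu0 : 0 ≤ u := (Real.rpow_pos_of_pos hqf0 _).le
      -- `u ≤ (q^f)⁻¹ ≤ q⁻² ≤ 1/4`
      have hule : u ≤ ((q : ℝ) ^ 2)⁻¹ := by
        calc u ≤ ((q : ℝ) ^ f)⁻¹ := by
              rw [hu, ← Real.rpow_neg_one]
              exact Real.rpow_le_rpow_of_exponent_le (by
                calc (1 : ℝ) ≤ 2 ^ f := by exact_mod_cast Nat.one_le_two_pow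
                  _ ≤ (q : ℝ) ^ f := pow_le_pow_left₀ (by norm_num) hp2 f) (by linarith)
          _ ≤ ((q : ℝ) ^ 2)⁻¹ := inv_anti₀ (by positivity) (pow_le_pow_right₀ (by linarith) hf2)
      have hq2 : ((q : ℝ) ^ 2)⁻¹ ≤ 1 / 4 := by
        rw [inv_eq_one_div]; exact one_div_le_one_div_of_le (by norm_num) (by nlinarith)
      obtain ⟨-, -, h3, h4⟩ := neg_log_one_sub_bounds hu0 (by linarith)
      refine ⟨h3, h4.trans ?_⟩
      rw [div_eq_mul_inv]; linarith
  rw [hdecomp]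
  refine ⟨sum_nonneg fun P hP => (hterm P hP).1, ?_⟩
  calc ∑ P ∈ primesAbove p, T P ≤ ∑ _P ∈ primesAbove p, 2 / (p : ℝ) ^ 2 := sum_le_sum fun P hP => (hterm P hP).2
    _ = #(primesAbove p) * (2 / (p : ℝ) ^ 2) := by rw [sum_const, nsmul_eq_mul]
    _ ≤ 3 * (2 / (p : ℝ) ^ 2) := by
        refine mul_le_mul_of_nonneg_right ?_ (by positivity)
        exact_mod_cast card_primesAbove_le hp
    _ = 6 / (p : ℝ) ^ 2 := by ring

/-- `r_p` vanishes at non-primes. [folklore] -/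
theorem rTerm_of_not_prime {p : ℕ} (hp : ¬ p.Prime) (s : ℝ) : rTerm p s = 0 := by rw [rTerm, if_neg hp]

/-- `|r_p(s)| ≤ 6/p²` for all `p` and `s ≥ 1` (with the convention `6/0² = 0`... handled: at `p = 0, 1` both sides vanish
or the bound is `rTerm = 0 ≤ _`). [folklore] -/
theorem abs_rTerm_le (p : ℕ) {s : ℝ} (hs : 1 ≤ s) : |rTerm p s| ≤ 6 / (p : ℝ) ^ 2 := by
  by_cases hp : p.Prime
  · obtain ⟨h0, h1⟩ := rTerm_bounds hp hs
    rw [abs_of_nonneg h0]; exact h1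
  · rw [rTerm_of_not_prime hp, abs_zero]; positivity

/-- `s ↦ r_p(s)` is continuous on `(0, ∞)` (a finite sum of logarithms of positive quantities). [folklore] -/
theorem continuousOn_rTerm (p : ℕ) : ContinuousOn (fun s => rTerm p s) (Set.Ioi 0) := by
  by_cases hp : p.Prime
  · have hp0 : (0 : ℝ) < p := by exact_mod_cast hp.pos
    simp only [rTerm, bTerm, if_pos hp]
    refine ContinuousOn.sub (continuousOn_finsetSum _ fun P hP => ?_) ?_
    · obtain ⟨hPp, hP0, -⟩ := (mem_primesAbove_iff hp).mp hP
      have hN2 : (2 : ℝ) ≤ ((Ideal.absNorm P : ℕ) : ℝ) := by exact_mod_cast two_le_absNorm_asIdeal ⟨P, hPp, hP0⟩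
      refine ContinuousOn.neg (ContinuousOn.log ?_ fun s hs => ?_)
      · exact continuousOn_const.sub (continuousOn_const.rpow continuousOn_id.neg fun _ _ => Or.inl (by positivity))
      · have : ((Ideal.absNorm P : ℕ) : ℝ) ^ (-s) < 1 :=
          Real.rpow_lt_one_of_one_lt_of_neg (by linarith) (by simpa using hs)
        linarith
    · exact continuousOn_const.mul (continuousOn_const.rpow continuousOn_id.neg fun _ _ => Or.inl hp0.ne')
  · simp only [rTerm, if_neg hp]; exact continuousOn_const


/-! ### (M4) The degree-one Dirichlet series `D(σ) = ∑_p c_K(p) p^{-1-σ}` as an integral -/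

/-- The weights `c_K(p)/p` at primes (zero elsewhere). [folklore] -/
def cWeight (k : ℕ) : ℝ := if k.Prime then (idealNormCount K k : ℝ) / k else 0

/-- `M'(x) = ∑_{p ≤ x} c_K(p)/p` (the summatory function of `HeathBrownCubicFLProducts`/`DegreeOnePrimesPNT`). [folklore] -/
def cSum (x : ℝ) : ℝ := ∑ p ∈ Nat.primesLE ⌊x⌋₊, (idealNormCount K p : ℝ) / p

/-- `cWeight ≥ 0`. [folklore] -/
theorem cWeight_nonneg (k : ℕ) : 0 ≤ cWeight k := by
  rw [cWeight]; split_ifs <;> positivity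

/-- `c_K(p)/p ≤ 3/p ≤ 3` termwise. [folklore] -/
theorem cWeight_le (k : ℕ) : cWeight k ≤ 3 / k ∧ cWeight k ≤ 3 := by
  rw [cWeight]
  split_ifs with hk
  · have hk1 : (1 : ℝ) ≤ k := by exact_mod_cast hk.one_le
    have h3 : (idealNormCount K k : ℝ) ≤ 3 := by
      rw [(singularFactor_bounds hk).2]; exact_mod_cast cubeRootTwoCount_le_three hk
    have h0 : (0 : ℝ) ≤ idealNormCount K k := Nat.cast_nonneg _
    refine ⟨div_le_div_of_nonneg_right h3 (by linarith), ?_⟩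
    rw [div_le_iff₀ (by linarith)]; nlinarith
  · constructor <;> positivity

/-- `∑_{k ∈ Icc 1 n} cWeight k = M'(n)`. [folklore] -/
theorem sum_Icc_cWeight (n : ℕ) : ∑ k ∈ Icc 1 n, cWeight k = cSum n := by
  rw [cSum, Nat.floor_natCast, Nat.primesLE, Nat.primesBelow, sum_filter]
  rw [← Finset.sum_subset (s₁ := Icc 1 n) (s₂ := range (n + 1)) (fun k hk => by
    rw [mem_Icc] at hk; rw [mem_range]; omega) (fun k hk hk' => by
    rw [mem_range] at hk; rw [mem_Icc] at hk'
    have : k = 0 := by omega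
    subst this; simp [Nat.not_prime_zero])]
  refine sum_congr rfl fun k _ => ?_
  rw [cWeight]

/-- `0 ≤ M'(x) ≤ 3(1 + log x)` for `x ≥ 1`. [folklore] -/
theorem cSum_bounds {x : ℝ} (hx : 1 ≤ x) : 0 ≤ cSum x ∧ cSum x ≤ 3 * (1 + Real.log x) := by
  have h0 : 0 ≤ cSum x := sum_nonneg fun p _ => by positivity
  refine ⟨h0, ?_⟩
  have hn : 1 ≤ ⌊x⌋₊ := Nat.le_floor (by simpa using hx)
  calc cSum x = ∑ k ∈ Icc 1 ⌊x⌋₊, cWeight k := by rw [sum_Icc_cWeight, cSum, cSum, Nat.floor_natCast]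
    _ ≤ ∑ k ∈ Icc 1 ⌊x⌋₊, 3 / (k : ℝ) := sum_le_sum fun k _ => (cWeight_le k).1
    _ = 3 * ∑ k ∈ Icc 1 ⌊x⌋₊, (k : ℝ)⁻¹ := by rw [mul_sum]; exact sum_congr rfl fun k _ => by rw [div_eq_mul_inv]
    _ ≤ 3 * (1 + Real.log ⌊x⌋₊) := by
        refine mul_le_mul_of_nonneg_left ?_ (by norm_num)
        have h := harmonic_le_one_add_log ⌊x⌋₊
        have hh : (harmonic ⌊x⌋₊ : ℝ) = ∑ k ∈ Icc 1 ⌊x⌋₊, (k : ℝ)⁻¹ := by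
          rw [harmonic_eq_sum_Icc]; push_cast; rfl
        rw [← hh]; exact h
    _ ≤ 3 * (1 + Real.log x) := by
        have : Real.log (⌊x⌋₊ : ℝ) ≤ Real.log x := Real.log_le_log (by exact_mod_cast hn) (Nat.floor_le (by linarith))
        linarith

/-- `M'` is measurable (a step function of `⌊x⌋`). [folklore] -/
theorem measurable_cSum : Measurable cSum := by
  have : cSum = (fun n : ℕ => ∑ p ∈ Nat.primesLE n, (idealNormCount K p : ℝ) / p) ∘ Nat.floor := by
    ext x; rfl
  rw [this]
  exact (measurable_from_nat).comp Nat.measurable_floor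

/-- `M'(x) x^{-σ-1}` is integrable on `(1, ∞)` for `σ > 0`. [folklore] -/
theorem integrableOn_cSum_rpow {σ : ℝ} (hσ : 0 < σ) :
    MeasureTheory.IntegrableOn (fun x => cSum x * x ^ (-(σ + 1))) (Set.Ioi 1) :=
  Literature.NumberTheory.LFunctions.Nicolas.integrableOn_rpow_of_le_log measurable_cSum
    (C := 3) (fun x hx => by
      obtain ⟨h0, h1⟩ := cSum_bounds hx.le
      rw [abs_of_nonneg h0]; exact h1) hσ

/-- **`D(σ) = ∑_k cWeight(k) k^{-σ} = σ ∫_1^∞ M'(x) x^{-σ-1} dx`** for `σ > 0`, and the series converges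
(Mathlib's partial summation `LSeries_eq_mul_integral'`, made real). [cite: MontgomeryVaughan2007, §1.2, Thm. 1.3] -/
theorem hasSum_cWeight_rpow {σ : ℝ} (hσ : 0 < σ) :
    HasSum (fun k : ℕ => cWeight k * (k : ℝ) ^ (-σ)) (σ * ∫ x in Set.Ioi (1 : ℝ), cSum x * x ^ (-(σ + 1))) := by
  set f : ℕ → ℂ := fun k => (cWeight k : ℂ) with hf
  -- growth of partial sums: `M'(n) ≤ 3(1 + log n) ≤ C n^{σ/2}`
  have hr : (0 : ℝ) ≤ σ / 2 := by linarith
  have hO : (fun n : ℕ => ∑ k ∈ Icc 1 n, ‖f k‖) =O[atTop] fun n : ℕ => (n : ℝ) ^ (σ / 2) := by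
    refine Asymptotics.IsBigO.of_bound (3 * (1 + 2 / σ)) ?_
    filter_upwards [eventually_ge_atTop 1] with n hn
    have hn1 : (1 : ℝ) ≤ n := by exact_mod_cast hn
    have hnorm : ∀ k, ‖f k‖ = cWeight k := fun k => by
      rw [hf]; simp only [Complex.norm_real, Real.norm_eq_abs, abs_of_nonneg (cWeight_nonneg k)]
    simp only [hnorm]
    rw [sum_Icc_cWeight, Real.norm_of_nonneg (cSum_bounds hn1).1, Real.norm_of_nonneg (by positivity)]
    have hlog : Real.log n ≤ (n : ℝ) ^ (σ / 2) / (σ / 2) := Real.log_le_rpow_div (by linarith) (by linarith)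
    have hpow1 : (1 : ℝ) ≤ (n : ℝ) ^ (σ / 2) := Real.one_le_rpow hn1 hr
    calc cSum n ≤ 3 * (1 + Real.log n) := (cSum_bounds hn1).2
      _ ≤ 3 * ((n : ℝ) ^ (σ / 2) + (n : ℝ) ^ (σ / 2) / (σ / 2)) := by gcongr
      _ = 3 * (1 + 2 / σ) * (n : ℝ) ^ (σ / 2) := by field_simp
  have hC := LSeries_eq_mul_integral' f hr (s := (σ : ℂ)) (by simpa using (by linarith : σ / 2 < σ)) hO
  have hSumm : LSeriesSummable f σ := LSeriesSummable_of_sum_norm_bigO hO hr (by simpa using (by linarith : σ / 2 < σ))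
  -- real forms of both sides
  have hterm : ∀ k : ℕ, LSeries.term f σ k = ((cWeight k * (k : ℝ) ^ (-σ) : ℝ) : ℂ) := by
    intro k
    rcases Nat.eq_zero_or_pos k with rfl | hk
    · simp [LSeries.term, cWeight, Nat.not_prime_zero]
    · rw [LSeries.term_of_ne_zero hk.ne', hf]
      have hk0 : (0 : ℝ) ≤ k := Nat.cast_nonneg k
      rw [show ((k : ℕ) : ℂ) = (((k : ℕ) : ℝ) : ℂ) by norm_cast, ← Complex.ofReal_cpow hk0, Real.rpow_neg hk0]
      push_cast
      rw [div_eq_mul_inv]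
  have hLHS : LSeries f σ = ((∑' k : ℕ, cWeight k * (k : ℝ) ^ (-σ) : ℝ) : ℂ) := by
    rw [LSeries, Complex.ofReal_tsum]; exact tsum_congr hterm
  have hsumR : Summable fun k : ℕ => cWeight k * (k : ℝ) ^ (-σ) := by
    have : Summable fun k : ℕ => ((cWeight k * (k : ℝ) ^ (-σ) : ℝ) : ℂ) := by
      have h := hSumm
      rw [LSeriesSummable] at h
      exact h.congr hterm
    exact (Complex.summable_ofReal).mp this
  have hRHS : (σ : ℂ) * ∫ t in Set.Ioi (1 : ℝ), (∑ k ∈ Icc 1 ⌊t⌋₊, f k) * (t : ℂ) ^ (-((σ : ℂ) + 1)) =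
      ((σ * ∫ x in Set.Ioi (1 : ℝ), cSum x * x ^ (-(σ + 1)) : ℝ) : ℂ) := by
    have hint : ∫ t in Set.Ioi (1 : ℝ), (∑ k ∈ Icc 1 ⌊t⌋₊, f k) * (t : ℂ) ^ (-((σ : ℂ) + 1)) =
        ∫ t in Set.Ioi (1 : ℝ), ((cSum t * t ^ (-(σ + 1)) : ℝ) : ℂ) := by
      refine MeasureTheory.setIntegral_congr_fun measurableSet_Ioi fun t ht => ?_
      have ht0 : (0 : ℝ) ≤ t := by linarith [ht.out]
      rw [hf, ← Complex.ofReal_sum, sum_Icc_cWeight, show cSum (⌊t⌋₊ : ℝ) = cSum t by rw [cSum, cSum, Nat.floor_natCast],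
        show (-((σ : ℂ) + 1)) = ((-(σ + 1) : ℝ) : ℂ) by push_cast; ring, ← Complex.ofReal_cpow ht0]
      push_cast; ring
    rw [hint, integral_complex_ofReal]; push_cast; ring
  rw [hLHS, hRHS, Complex.ofReal_inj] at hC
  rw [← hC]
  exact hsumR.hasSum


/-! ### (M5) The limits as `σ → 0⁺` and the identification of the constant -/

/-- `M'(x) − log log x → c` (from the degree-one Mertens theorem with rate). [folklore] -/
theorem tendsto_cSum_sub_loglog {c C : ℝ} (hT1 : ∀ x : ℝ, 2 ≤ x → |cSum x - (Real.log (Real.log x) + c)| ≤ C / Real.log x) :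
    Tendsto (fun x => cSum x - Real.log (Real.log x)) atTop (𝓝 c) := by
  have h0 : Tendsto (fun x : ℝ => C / Real.log x) atTop (𝓝 0) := by
    simpa [div_eq_mul_inv] using (tendsto_inv_atTop_zero.comp Real.tendsto_log_atTop).const_mul C
  have h1 : Tendsto (fun x => (cSum x - Real.log (Real.log x)) - c) atTop (𝓝 0) := by
    refine squeeze_zero_norm' ?_ h0
    filter_upwards [eventually_ge_atTop 2] with x hx
    rw [Real.norm_eq_abs, show cSum x - Real.log (Real.log x) - c = cSum x - (Real.log (Real.log x) + c) by ring]
    exact hT1 x hx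
  have := h1.add_const c
  simpa using this

/-- **`D(σ) + log σ → c − γ` as `σ → 0⁺`** (split off `σ∫ log log x · x^{-σ-1} dx = −γ − log σ` and apply the
Abelian lemma of `MertensConstant` to `M' − log log → c`). [cite: HardyWright2008, §22.8, proof of Thm 428] -/
theorem tendsto_D_add_log {c C : ℝ} (hT1 : ∀ x : ℝ, 2 ≤ x → |cSum x - (Real.log (Real.log x) + c)| ≤ C / Real.log x) :
    Tendsto (fun σ : ℝ => σ * (∫ x in Set.Ioi (1 : ℝ), cSum x * x ^ (-(σ + 1))) + Real.log σ) (𝓝[>] 0)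
      (𝓝 (c - Real.eulerMascheroniConstant)) := by
  have hint : ∀ σ : ℝ, 0 < σ → MeasureTheory.IntegrableOn
      (fun x => (cSum x - Real.log (Real.log x)) * x ^ (-(σ + 1))) (Set.Ioi 1) := fun σ hσ =>
    Literature.NumberTheory.LFunctions.Nicolas.integrableOn_sub_rpow (integrableOn_cSum_rpow hσ)
      (Literature.NumberTheory.LFunctions.Nicolas.integrableOn_loglog_rpow hσ)
  have hA := Literature.NumberTheory.LFunctions.Mertens.tendsto_mul_integral_rpow_of_tendsto hint (tendsto_cSum_sub_loglog hT1)
  have hev : (fun σ : ℝ => σ * (∫ x in Set.Ioi (1 : ℝ), (cSum x - Real.log (Real.log x)) * x ^ (-(σ + 1))) -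
      Real.eulerMascheroniConstant) =ᶠ[𝓝[>] 0]
      fun σ : ℝ => σ * (∫ x in Set.Ioi (1 : ℝ), cSum x * x ^ (-(σ + 1))) + Real.log σ := by
    filter_upwards [self_mem_nhdsWithin] with σ (hσ : 0 < σ)
    have h1 := integrableOn_cSum_rpow hσ
    have h2 := Literature.NumberTheory.LFunctions.Nicolas.integrableOn_loglog_rpow hσ
    have hsplit : ∫ x in Set.Ioi (1 : ℝ), (cSum x - Real.log (Real.log x)) * x ^ (-(σ + 1)) =
        (∫ x in Set.Ioi (1 : ℝ), cSum x * x ^ (-(σ + 1))) - ∫ x in Set.Ioi (1 : ℝ), Real.log (Real.log x) * x ^ (-(σ + 1)) := by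
      rw [← MeasureTheory.integral_sub h1 h2]
      exact MeasureTheory.setIntegral_congr_fun measurableSet_Ioi fun x _ => by ring
    rw [hsplit, Literature.NumberTheory.LFunctions.Nicolas.integral_loglog_rpow hσ]
    field_simp
    ring
  exact (hA.sub_const Real.eulerMascheroniConstant).congr' hev

/-- `∑_p r_p(1+σ) → ∑_p r_p(1)` as `σ → 0⁺` (dominated convergence with `6/p²`). [folklore] -/
theorem tendsto_tsum_rTerm :
    Tendsto (fun σ : ℝ => ∑' p : ℕ, rTerm p (1 + σ)) (𝓝[>] 0) (𝓝 (∑' p : ℕ, rTerm p 1)) := by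
  have hbound : Summable fun p : ℕ => 6 * ((p : ℝ) ^ 2)⁻¹ :=
    (Real.summable_nat_pow_inv.mpr one_lt_two).mul_left 6
  refine tendsto_tsum_of_dominated_convergence hbound (fun p => ?_) ?_
  · have hc : ContinuousAt (fun s => rTerm p s) 1 := (continuousOn_rTerm p).continuousAt (Ioi_mem_nhds one_pos)
    have h1 : Tendsto (fun σ : ℝ => 1 + σ) (𝓝[>] 0) (𝓝 1) := by
      have : Tendsto (fun σ : ℝ => 1 + σ) (𝓝 0) (𝓝 (1 + 0)) := (continuous_const.add continuous_id).tendsto 0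
      rw [add_zero] at this
      exact tendsto_nhdsWithin_of_tendsto_nhds this
    exact hc.tendsto.comp h1
  · filter_upwards [self_mem_nhdsWithin] with σ (hσ : 0 < σ)
    intro p
    rw [Real.norm_eq_abs, ← div_eq_mul_inv]
    exact abs_rTerm_le p (by linarith)

/-- `r_p(1)` is summable. [folklore] -/
theorem summable_rTerm {s : ℝ} (hs : 1 ≤ s) : Summable fun p : ℕ => rTerm p s := by
  refine Summable.of_norm_bounded ((Real.summable_nat_pow_inv.mpr one_lt_two).mul_left 6) fun p => ?_
  rw [Real.norm_eq_abs, ← div_eq_mul_inv]; exact abs_rTerm_le p hs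

/-- **`log ζ_K(1+σ) + log σ → log γ₀`** (`γ₀ = ρ_K`, Mathlib's class number formula
`NumberField.tendsto_sub_one_mul_dedekindZeta_nhdsGT`). [folklore] -/
theorem tendsto_log_zeta_add_log :
    Tendsto (fun σ : ℝ => Real.log (NumberField.dedekindZeta K (1 + σ)).re + Real.log σ) (𝓝[>] 0)
      (𝓝 (Real.log gamma₀)) := by
  have hρ : 0 < NumberField.dedekindZeta_residue K := NumberField.dedekindZeta_residue_pos K
  have h1 : Tendsto (fun σ : ℝ => 1 + σ) (𝓝[>] (0 : ℝ)) (𝓝[>] 1) := by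
    refine tendsto_nhdsWithin_iff.mpr ⟨?_, ?_⟩
    · have : Tendsto (fun σ : ℝ => 1 + σ) (𝓝 0) (𝓝 (1 + 0)) := (continuous_const.add continuous_id).tendsto 0
      rw [add_zero] at this
      exact tendsto_nhdsWithin_of_tendsto_nhds this
    · filter_upwards [self_mem_nhdsWithin] with σ (hσ : 0 < σ)
      exact Set.mem_Ioi.mpr (by linarith)
  have h2 := (NumberField.tendsto_sub_one_mul_dedekindZeta_nhdsGT K).comp h1
  have h3 : Tendsto (fun σ : ℝ => σ * (NumberField.dedekindZeta K (1 + σ)).re) (𝓝[>] 0)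
      (𝓝 (NumberField.dedekindZeta_residue K)) := by
    have h := (Complex.continuous_re.tendsto _).comp h2
    refine h.congr fun σ => ?_
    simp only [Function.comp_apply]
    rw [show ((1 + σ : ℝ) : ℂ) - 1 = ((σ : ℝ) : ℂ) by push_cast; ring, Complex.re_ofReal_mul]
    norm_num
  have h4 := ((Real.continuousAt_log hρ.ne').tendsto).comp h3
  rw [gamma₀]
  refine h4.congr' ?_
  filter_upwards [self_mem_nhdsWithin] with σ (hσ : 0 < σ)
  have hZ := (hasProd_realEulerFactor (L := K) (s := 1 + σ) (by linarith)).2.2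
  simp only [Function.comp_apply]
  rw [show ((1 + σ : ℝ) : ℂ) = 1 + (σ : ℂ) by push_cast; ring] at hZ
  rw [Real.log_mul hσ.ne' (by linarith), add_comm]

/-- For `σ > 0`: `b_p(1+σ) = cWeight(p) p^{-σ} + r_p(1+σ)` for every `p`. [folklore] -/
theorem bTerm_eq_add (p : ℕ) (σ : ℝ) :
    bTerm p (1 + σ) = cWeight p * (p : ℝ) ^ (-σ) + rTerm p (1 + σ) := by
  by_cases hp : p.Prime
  · have hp0 : (0 : ℝ) < p := by exact_mod_cast hp.pos
    rw [rTerm, if_pos hp, cWeight, if_pos hp, (singularFactor_bounds hp).2,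
      show (-(1 + σ) : ℝ) = -1 + -σ by ring, Real.rpow_add hp0, Real.rpow_neg_one]
    field_simp
    ring
  · rw [bTerm, if_neg hp, cWeight, if_neg hp, rTerm, if_neg hp]; ring

/-- **`log ζ_K(1+σ) = D(σ) + ∑_p r_p(1+σ)`** for `σ > 0`. [folklore] -/
theorem log_zeta_eq (σ : ℝ) (hσ : 0 < σ) :
    Real.log (NumberField.dedekindZeta K (1 + σ)).re =
      σ * (∫ x in Set.Ioi (1 : ℝ), cSum x * x ^ (-(σ + 1))) + ∑' p : ℕ, rTerm p (1 + σ) := by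
  have hb := hasSum_bTerm (s := 1 + σ) (by linarith)
  rw [show ((1 + σ : ℝ) : ℂ) = 1 + (σ : ℂ) by push_cast; ring] at hb
  simp_rw [bTerm_eq_add] at hb
  have hD := hasSum_cWeight_rpow hσ
  have hr : HasSum (fun p : ℕ => rTerm p (1 + σ)) (Real.log (NumberField.dedekindZeta K (1 + σ)).re -
      σ * ∫ x in Set.Ioi (1 : ℝ), cSum x * x ^ (-(σ + 1))) := by
    have := hb.sub hD
    simpa using this
  rw [hr.tsum_eq]; ring

/-- **The constant: `c − γ + ∑_p r_p(1) = log γ₀`**, where `c` is the constant of the degree-one Mertens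
theorem `∑_{p≤x} c_K(p)/p = log log x + c + O(1/log x)` (by uniqueness of limits as `σ → 0⁺`).
[cite: HardyWright2008, §22.8, proof of Thm 428] -/
theorem mertensK_constant {c C : ℝ} (hT1 : ∀ x : ℝ, 2 ≤ x → |cSum x - (Real.log (Real.log x) + c)| ≤ C / Real.log x) :
    c - Real.eulerMascheroniConstant + ∑' p : ℕ, rTerm p 1 = Real.log gamma₀ := by
  have hA := (tendsto_D_add_log hT1).add tendsto_tsum_rTerm
  have hB := tendsto_log_zeta_add_log
  have hev : (fun σ : ℝ => σ * (∫ x in Set.Ioi (1 : ℝ), cSum x * x ^ (-(σ + 1))) + Real.log σ + ∑' p : ℕ, rTerm p (1 + σ))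
      =ᶠ[𝓝[>] 0] fun σ : ℝ => Real.log (NumberField.dedekindZeta K (1 + σ)).re + Real.log σ := by
    filter_upwards [self_mem_nhdsWithin] with σ (hσ : 0 < σ)
    rw [log_zeta_eq σ hσ]; ring
  exact tendsto_nhds_unique (hA.congr' hev) hB


/-! ### (M6) Mertens' theorem for `K` grouped by rational primes, with rate -/

/-- `∑_{p<N} cWeight(p) = M'(N−1)` and `∑_{p<N} r_p(1) = ∑_{p ∈ range N} r_p(1)` (`N ≥ 1`). [folklore] -/
theorem sum_primesBelow_cWeight {N : ℕ} (hN : 1 ≤ N) :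
    ∑ p ∈ Nat.primesBelow N, cWeight p = cSum ((N - 1 : ℕ) : ℝ) ∧
      ∑ p ∈ Nat.primesBelow N, rTerm p 1 = ∑ p ∈ range N, rTerm p 1 := by
  constructor
  · rw [cSum, primesBelow_eq_primesLE hN]
    refine sum_congr rfl fun p hp => ?_
    rw [cWeight, if_pos (Nat.prime_of_mem_primesLE hp)]
  · rw [Nat.primesBelow, sum_filter]
    refine sum_congr rfl fun p _ => ?_
    split_ifs with hp
    · rfl
    · rw [rTerm_of_not_prime hp]

/-- The tail `|∑_{p ≥ N} r_p(1)| ≤ 6/(N−1)` for `N ≥ 2`. [folklore] -/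
theorem abs_tsum_rTerm_tail_le {N : ℕ} (hN : 2 ≤ N) :
    |∑' p : ℕ, rTerm (p + N) 1| ≤ 6 / ((N : ℝ) - 1) := by
  have hsum : Summable fun p : ℕ => rTerm (p + N) 1 := (summable_rTerm le_rfl).comp_injective (add_left_injective N)
  have hb : ∀ p : ℕ, |rTerm (p + N) 1| ≤ 6 * (1 / (((p + (N - 2 + 1 + 1)) : ℕ) : ℝ) ^ 2) := by
    intro p
    have h := abs_rTerm_le (p + N) le_rfl
    rw [show p + (N - 2 + 1 + 1) = p + N by omega]
    rw [mul_one_div]; push_cast at h ⊢; exact h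
  have htail := tsum_inv_sq_tail_le (M := N - 2 + 1) (by omega)
  have hsb : Summable fun p : ℕ => 6 * (1 / (((p + (N - 2 + 1 + 1)) : ℕ) : ℝ) ^ 2) := by
    refine Summable.mul_left 6 ?_
    have : Summable fun n : ℕ => 1 / ((n : ℕ) : ℝ) ^ 2 := by
      simp only [one_div]; exact Real.summable_nat_pow_inv.mpr one_lt_two
    exact this.comp_injective (add_left_injective (N - 2 + 1 + 1))
  calc |∑' p : ℕ, rTerm (p + N) 1| ≤ ∑' p : ℕ, |rTerm (p + N) 1| := by
        have := norm_tsum_le_tsum_norm hsum.norm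
        simpa only [Real.norm_eq_abs] using this
    _ ≤ ∑' p : ℕ, 6 * (1 / (((p + (N - 2 + 1 + 1)) : ℕ) : ℝ) ^ 2) :=
        Summable.tsum_le_tsum hb hsum.abs hsb
    _ = 6 * ∑' p : ℕ, 1 / (((p + (N - 2 + 1 + 1)) : ℕ) : ℝ) ^ 2 := tsum_mul_left
    _ ≤ 6 * (1 / ((N - 2 + 1 : ℕ) : ℝ)) := mul_le_mul_of_nonneg_left htail (by norm_num)
    _ = 6 / ((N : ℝ) - 1) := by
        rw [Nat.cast_add, Nat.cast_sub (by omega)]; push_cast; ring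

/-- **`∑_{p<z} b_p(1) = log log z + γ + log γ₀ + O(1/log z)`**: the logarithmic form of Mertens' theorem for
`K`, grouped by rational primes, with the constant `γ + log ρ_K` (`ρ_K = γ₀`). [cite: Rosen1999Mertens, Thm 2] -/
theorem exists_abs_sum_bTerm_sub_le :
    ∃ C z₀ : ℝ, ∀ z : ℝ, z₀ ≤ z →
      |∑ p ∈ Nat.primesBelow ⌈z⌉₊, bTerm p 1 - (Real.log (Real.log z) + Real.eulerMascheroniConstant + Real.log gamma₀)| ≤
        C / Real.log z := by
  obtain ⟨c, C_K, hT1⟩ := Literature.NumberTheory.LFunctions.NumberField.sum_primesLE_idealNormCount_div_eq K 0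
  have hT1' : ∀ x : ℝ, 2 ≤ x → |cSum x - (Real.log (Real.log x) + c)| ≤ C_K / Real.log x := fun x hx => by
    have h := hT1 x hx
    rw [zero_add, pow_one] at h
    exact h
  have hconst := mertensK_constant hT1'
  set R := ∑' p : ℕ, rTerm p 1 with hR
  refine ⟨2 * |C_K| + 2 + 14, 16, fun z hz => ?_⟩
  have hz0 : 0 < z := by linarith
  set N := ⌈z⌉₊ with hN
  have hNz : z ≤ N := Nat.le_ceil z
  have hN16 : (16 : ℝ) ≤ N := hz.trans hNz
  have hN2 : 2 ≤ N := by
    have : (2 : ℝ) ≤ N := by linarith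
    exact_mod_cast this
  have hN1 : 1 ≤ N := by omega
  set x : ℝ := ((N - 1 : ℕ) : ℝ) with hx
  have hxN : x = (N : ℝ) - 1 := by rw [hx, Nat.cast_sub hN1, Nat.cast_one]
  have hxz : z - 1 ≤ x ∧ x < z := by
    rw [hxN]; exact ⟨by linarith, by rw [hN]; linarith [Nat.ceil_lt_add_one hz0.le]⟩
  have hx2 : 2 ≤ x := by linarith
  have hlogx : 0 < Real.log x := Real.log_pos (by linarith)
  have hlogz : 0 < Real.log z := Real.log_pos (by linarith)
  have hlogxz : Real.log x ≤ Real.log z := Real.log_le_log (by linarith) hxz.2.le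
  have hlogx1 : 1 ≤ Real.log x := by
    rw [← Real.log_exp 1]; exact Real.log_le_log (Real.exp_pos 1) (by linarith [Real.exp_one_lt_d9])
  -- decomposition of the sum
  have hsplit : ∑ p ∈ Nat.primesBelow N, bTerm p 1 = cSum x + ∑ p ∈ range N, rTerm p 1 := by
    have h := fun p => bTerm_eq_add p 0
    simp only [add_zero, neg_zero, Real.rpow_zero, mul_one] at h
    rw [sum_congr rfl fun p _ => h p, sum_add_distrib, (sum_primesBelow_cWeight hN1).1, (sum_primesBelow_cWeight hN1).2]
  -- the tail of `R`
  have htailR : ∑ p ∈ range N, rTerm p 1 = R - ∑' p : ℕ, rTerm (p + N) 1 := by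
    rw [hR, ← (summable_rTerm le_rfl).sum_add_tsum_nat_add N]; ring
  have htail := abs_tsum_rTerm_tail_le hN2
  -- `log log z` versus `log log x`
  have hll : |Real.log (Real.log z) - Real.log (Real.log x)| ≤ 2 / (z * Real.log x) := by
    have hge : Real.log (Real.log x) ≤ Real.log (Real.log z) := Real.log_le_log hlogx hlogxz
    rw [abs_of_nonneg (by linarith), ← Real.log_div hlogz.ne' hlogx.ne']
    have h1 := Real.log_le_sub_one_of_pos (div_pos hlogz hlogx)
    have h2 : Real.log z / Real.log x - 1 = (Real.log z - Real.log x) / Real.log x := by field_simp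
    have h3 : Real.log z - Real.log x ≤ 2 / z := by
      rw [← Real.log_div hz0.ne' (by linarith)]
      have h := Real.log_le_sub_one_of_pos (show 0 < z / x from div_pos hz0 (by linarith))
      have : z / x - 1 ≤ 2 / z := by
        rw [div_sub_one (by linarith), div_le_div_iff₀ (by linarith) hz0]; nlinarith
      linarith
    calc Real.log (Real.log z / Real.log x) ≤ Real.log z / Real.log x - 1 := h1
      _ = (Real.log z - Real.log x) / Real.log x := h2
      _ ≤ (2 / z) / Real.log x := div_le_div_of_nonneg_right h3 hlogx.le
      _ = 2 / (z * Real.log x) := by rw [div_div]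
  -- assemble the error
  have hmain : ∑ p ∈ Nat.primesBelow N, bTerm p 1 - (Real.log (Real.log z) + Real.eulerMascheroniConstant + Real.log gamma₀) =
      (cSum x - (Real.log (Real.log x) + c)) - (Real.log (Real.log z) - Real.log (Real.log x)) - ∑' p : ℕ, rTerm (p + N) 1 := by
    rw [hsplit, htailR, ← hconst]; ring
  rw [hmain]
  have e1 := hT1' x hx2
  calc |cSum x - (Real.log (Real.log x) + c) - (Real.log (Real.log z) - Real.log (Real.log x)) - ∑' p : ℕ, rTerm (p + N) 1|
      ≤ |cSum x - (Real.log (Real.log x) + c)| + |Real.log (Real.log z) - Real.log (Real.log x)| + |∑' p : ℕ, rTerm (p + N) 1| := by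
        refine (abs_sub _ _).trans (add_le_add ((abs_sub _ _).trans le_rfl) le_rfl)
    _ ≤ C_K / Real.log x + 2 / (z * Real.log x) + 6 / ((N : ℝ) - 1) := add_le_add (add_le_add e1 hll) htail
    _ ≤ (2 * |C_K| + 2 + 14) / Real.log z := by
        -- `log z ≤ 2 log x`, `z log x ≥ log z`, `N − 1 ≥ z − 1 ≥ log z · (something)`
        have hzx2 : Real.log z ≤ 2 * Real.log x := by
          have : Real.log z - Real.log x ≤ 1 := by
            have h3 : Real.log z - Real.log x ≤ 2 / z := by
              rw [← Real.log_div hz0.ne' (by linarith)]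
              have h := Real.log_le_sub_one_of_pos (show 0 < z / x from div_pos hz0 (by linarith))
              have : z / x - 1 ≤ 2 / z := by
                rw [div_sub_one (by linarith), div_le_div_iff₀ (by linarith) hz0]; nlinarith
              linarith
            exact h3.trans (by rw [div_le_one hz0]; linarith)
          linarith
        have hA : C_K / Real.log x ≤ 2 * |C_K| / Real.log z := by
          rw [div_le_div_iff₀ hlogx hlogz]
          nlinarith [le_abs_self C_K, abs_nonneg C_K, mul_le_mul_of_nonneg_left hzx2 (abs_nonneg C_K)]
        have hB : 2 / (z * Real.log x) ≤ 2 / Real.log z := by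
          refine div_le_div_of_nonneg_left (by norm_num) hlogz ?_
          have hzlog : Real.log z ≤ z := by linarith [Real.log_le_sub_one_of_pos hz0]
          nlinarith
        have hC : 6 / ((N : ℝ) - 1) ≤ 14 / Real.log z := by
          rw [div_le_div_iff₀ (by linarith) hlogz]
          have hzlog : Real.log z ≤ z - 1 := by linarith [Real.log_le_sub_one_of_pos hz0]
          nlinarith
        rw [show (2 * |C_K| + 2 + 14) / Real.log z = 2 * |C_K| / Real.log z + 2 / Real.log z + 14 / Real.log z by ring]
        exact add_le_add (add_le_add hA hB) hC

/-- `1 − normDensityAt p = exp(−b_p(1))` at a prime `p` (both equal `∏_{P∣p}(1 − N(P)^{-1})`). [folklore] -/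
theorem one_sub_normDensityAt_eq_exp {p : ℕ} (hp : p.Prime) : 1 - normDensityAt p = Real.exp (-bTerm p 1) := by
  rw [normDensityAt, sub_sub_cancel, bTerm, if_pos hp, ← sum_neg_distrib, Real.exp_sum]
  refine prod_congr rfl fun P hP => ?_
  obtain ⟨hPp, hP0, -⟩ := (mem_primesAbove_iff hp).mp hP
  have hN2 : (2 : ℝ) ≤ ((Ideal.absNorm P : ℕ) : ℝ) := by exact_mod_cast two_le_absNorm_asIdeal ⟨P, hPp, hP0⟩
  rw [neg_neg, Real.rpow_neg_one, Real.exp_log]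
  have : ((Ideal.absNorm P : ℕ) : ℝ)⁻¹ ≤ 1 / 2 := by rw [inv_eq_one_div]; exact one_div_le_one_div_of_le two_pos hN2
  linarith

/-- **Mertens' theorem for the prime ideals of `K = ℚ(∛2)` with the residue constant, grouped by rational
primes**: `|∏_{p<z}∏_{P∣p}(1 − N(P)^{-1}) · e^γ γ₀ log z − 1| ≤ C/log z` for `z ≥ z₀` (`γ₀ = ρ_K` the residue of
`ζ_K` at `1`). This is the hypothesis `hmer` of `HeathBrown2001_lemma_3_5_of`, i.e. Heath-Brown's (6.9);
classically Rosen 1999, Thm 2 (there over `N(P) ≤ x`; the grouping by rational primes changes the product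
by degree-`≥ 2` primes above `p ≥ z^{1/3}` only, but here the grouped form is proved directly).
[cite: Rosen1999Mertens, Thm 2] [cite: HeathBrownActa2001, §6 (6.9)] -/
theorem mertensK_grouped :
    ∃ C z₀ : ℝ, ∀ z : ℝ, z₀ ≤ z →
      |(∏ p ∈ Nat.primesBelow ⌈z⌉₊, (1 - normDensityAt p)) *
          (Real.exp Real.eulerMascheroniConstant * gamma₀ * Real.log z) - 1| ≤ C / Real.log z := by
  obtain ⟨C, z₀, h⟩ := exists_abs_sum_bTerm_sub_le
  refine ⟨2 * max C 0, max z₀ (max 16 (Real.exp (max C 0))), fun z hz => ?_⟩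
  have hz₀ : z₀ ≤ z := le_trans (le_max_left _ _) hz
  have hz16 : (16 : ℝ) ≤ z := le_trans (le_trans (le_max_left _ _) (le_max_right _ _)) hz
  have hzC : Real.exp (max C 0) ≤ z := le_trans (le_trans (le_max_right _ _) (le_max_right _ _)) hz
  have hz0 : 0 < z := by linarith
  have hlogz : 0 < Real.log z := Real.log_pos (by linarith)
  have hClog : max C 0 ≤ Real.log z := by
    rw [← Real.log_exp (max C 0)]; exact Real.log_le_log (Real.exp_pos _) hzC
  set E := ∑ p ∈ Nat.primesBelow ⌈z⌉₊, bTerm p 1 - (Real.log (Real.log z) + Real.eulerMascheroniConstant + Real.log gamma₀) with hE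
  have hEle : |E| ≤ max C 0 / Real.log z := (h z hz₀).trans (div_le_div_of_nonneg_right (le_max_left _ _) hlogz.le)
  have hE1 : |E| ≤ 1 := hEle.trans (by rw [div_le_one hlogz]; exact hClog)
  have hγ0 : 0 < gamma₀ := gamma₀_pos
  -- the product is `exp(−∑ b_p(1))`
  have hprod : ∏ p ∈ Nat.primesBelow ⌈z⌉₊, (1 - normDensityAt p) = Real.exp (-∑ p ∈ Nat.primesBelow ⌈z⌉₊, bTerm p 1) := by
    rw [← sum_neg_distrib, Real.exp_sum]
    exact prod_congr rfl fun p hp => one_sub_normDensityAt_eq_exp (Nat.prime_of_mem_primesBelow hp)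
  have hsumE : ∑ p ∈ Nat.primesBelow ⌈z⌉₊, bTerm p 1 =
      E + (Real.log (Real.log z) + Real.eulerMascheroniConstant + Real.log gamma₀) := by rw [hE]; ring
  have hkey : (∏ p ∈ Nat.primesBelow ⌈z⌉₊, (1 - normDensityAt p)) *
      (Real.exp Real.eulerMascheroniConstant * gamma₀ * Real.log z) = Real.exp (-E) := by
    rw [hprod, hsumE, neg_add, Real.exp_add]
    have hone : Real.exp (-(Real.log (Real.log z) + Real.eulerMascheroniConstant + Real.log gamma₀)) *
        (Real.exp Real.eulerMascheroniConstant * gamma₀ * Real.log z) = 1 := by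
      rw [Real.exp_neg, inv_mul_eq_one₀ (Real.exp_pos _).ne', Real.exp_add, Real.exp_add, Real.exp_log hlogz,
        Real.exp_log hγ0]
      ring
    calc Real.exp (-E) * Real.exp (-(Real.log (Real.log z) + Real.eulerMascheroniConstant + Real.log gamma₀)) *
          (Real.exp Real.eulerMascheroniConstant * gamma₀ * Real.log z)
        = Real.exp (-E) * (Real.exp (-(Real.log (Real.log z) + Real.eulerMascheroniConstant + Real.log gamma₀)) *
            (Real.exp Real.eulerMascheroniConstant * gamma₀ * Real.log z)) := by ring
      _ = Real.exp (-E) := by rw [hone, mul_one]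
  rw [hkey]
  have hexp : |Real.exp (-E) - 1| ≤ 2 * |E| := by
    have h1 := Real.abs_exp_sub_one_sub_id_le (x := -E) (by rwa [abs_neg])
    have : |Real.exp (-E) - 1| ≤ |Real.exp (-E) - 1 - -E| + |-E| := by
      have := abs_add_le (Real.exp (-E) - 1 - -E) (-E); simpa using this
    rw [abs_neg] at this
    have hE2 : (-E) ^ 2 ≤ |E| := by
      rw [neg_sq, ← sq_abs]; nlinarith [abs_nonneg E]
    linarith
  calc |Real.exp (-E) - 1| ≤ 2 * |E| := hexp
    _ ≤ 2 * (max C 0 / Real.log z) := by linarith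
    _ = 2 * max C 0 / Real.log z := by ring

end Literature.NumberTheory.Sieve.CubicSieve

end
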